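import Summits.QuantumFields.YangMills.Theorems.BalabanUVNodesK0V23Defs

/-!
# CRIT-1 g32 — GLUE-ρ2 «U4∕ρ2 AT THE RECORD»: the typed ANTECEDENT with the (J1)–(J4) junk guards
(director-ym №435 ORDER (b); source lens-2 g3 `TREE-CENSUS-lens2-g3.md` 88591cbe0c1b6975 §3 (5); critic of record CRIT-1 g32)

WHAT THIS FILE IS. A typed PROPOSITION (no proof of anything of Bałaban's): the antecedent «analytic-in-the-coupling
(1.18)-format leaves of the RECORD's effective actions along the window, with k-UNIFORM constants», written so that
(J1) every data field except the pieces `E` is a PARAMETER to be instantiated BY NAME (DEF-1's record definitions),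
(J2) the represented functional `Φ` is a parameter (the record's `Φf` at real coupling, by name), (J3) the constants
`γ r E₀ κ` sit OUTSIDE every inner binder, (J4) the analyticity domains `Uc` and the locality supports `coords` are
parameters (print's `U^c_{k+1}(X, α₀, α₁)`, p.262 (i)–(iv), and the bond set of `X`).  The ONLY existential is over the
pieces `E` (mould (M), HOME STATUS l.3464).  Plus two kernel-checked JUNK FACTS that justify the guards:
`zero_pieces_force_functional_zero` (the `E := 0` junk inhabits the representation clause only where `Φ ≡ 0` near `0`)
and `glue_forall_data_imp_target` (the glue with the data tuple UNIVERSALLY quantified instead of instantiated by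
name is 2′ ITSELF in costume — instantiate the index type at `PEmpty`), so neither the `∃ data` nor the `∀ data`
variant may be filed: only the BY-NAME instantiation is a helper target.

CURRENCY MAP to `B12PolarizationHolo.betaClauses_of_analytic_leaves` :366 (the intended consumer): its
`EXn n g X v` := `E i g X (χ i X v)` (index `n` ↔ our `i : ι` = (step k, window K, earlier history)), its `U` := a
neighbourhood inside `cStrip γ r`, its `h118` := clause (ii), its `han` := clause (i) composed with the analyticity of
the chart `χ i X` (record side, by name), its `hh`∕`hgeo`∕`hcube`∕`htree`∕`hlim`∕`beta_eq` := the record's RESPONSE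
decay (PT-B, item 27931, by name), the n09 geometry leaves, `PolLimitsExistOfRecord₁₃`, and the identification Q1′ —
all DISPLAYED antecedents of the glue, none hidden here.

HONEST FRAMING. Nothing of [RG-I] is asserted, ported or discharged; stub 2′ OPEN; K0⁷ NOT closed; NODE O not
inhabited; COUNT 8∕28 · K 1∕4 UNMOVED; finite 𝕋⁴ at fixed ε — not continuum ∕ OS ∕ Clay; R4 closes only the
conditional finite-𝕋⁴ rung `BalabanLadder.UV`; the Yang–Mills mass gap (Clay) is NOT proved by any of this.
-/

noncomputable section

open scoped BigOperators Topology
open Set Filter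

namespace Summit.QuantumFields.YangMills.Cruxes.Record13SepCoPHInhabited.Crit1GlueRho2

open Literature.MathematicalPhysics.QuantumFieldTheory.Balaban1983to89
open Literature.MathematicalPhysics.QuantumFieldTheory.Balaban1983to89.T4Continuum (T4Family)
open Summit.QuantumFields.YangMills.Theorems.K0V23Defs (AbsBetaBoxAtThm1WitnessCCMGenGridGZBAt)

/-- The open `r`-strip about the real coupling interval `[0, γ]` in the complex coupling plane
([I] p.266, the «(or analytic)» alternative: `β_{k+1}` extends to a complex neighbourhood of `[0, γ]`). -/
def cStrip (γ r : ℝ) : Set ℂ := Metric.thickening r ((fun t : ℝ => (t : ℂ)) '' Icc 0 γ)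

/-- **ANTECEDENT of GLUE-ρ2, junk-guarded.**  Index `i : ι` ranges over (step `k`, window `K`, earlier history) of the
box∕window (instantiated by name); `S i` = the record's localization domains `D_{k+1}` (`recordDomSys …`), `M i` = its
bond-coordinate count, `Uc i X` = `U^c_{k+1}(X, α₀, α₁)` in record coordinates, `coords i X` = the bonds of `X`,
`χ i X` = `recordChart ∘ recordEmb` (history `B ↦` coordinates on `X`), `Φ i g` = the record's effective-action
functional at real last coupling `g` as a function of the history perturbation `B` (lens-1 `recordΦf`, by name).
Clauses: (i) joint analyticity of each piece in (complex coupling, coordinates) on `cStrip γ r ×ˢ Uc i X`;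
(ii) the (1.18) bound there with ABSOLUTE `E₀, κ`; (iii) locality through `coords` (kills the one-piece junk);
(iv) the (S1) representation of `Φ` BY NAME near `B = 0` at every real coupling in `[0, γ]` (kills `E := 0`).
[cite: Balaban1987RG1, (1.18) p.263 («There exists a constant E₀»), p.264 Thm 3 β-clause, p.266 analytic alternative] -/
def AnalyticLeavesUniform (ι : Type) (S : ι → LocDomainSys) (M : ι → ℕ)
    (Uc : (i : ι) → (S i).Dom → Set (Fin (M i) → ℂ)) (coords : (i : ι) → (S i).Dom → Finset (Fin (M i)))
    (W : ι → Type) [∀ i, TopologicalSpace (W i)] [∀ i, Zero (W i)]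
    (χ : (i : ι) → (S i).Dom → W i → (Fin (M i) → ℂ)) (Φ : (i : ι) → ℝ → W i → ℂ)
    (γ r E₀ κ : ℝ) : Prop :=
  ∃ E : (i : ι) → ℂ → (S i).Dom → (Fin (M i) → ℂ) → ℂ,
    (∀ i X, AnalyticOnNhd ℂ (fun p : ℂ × (Fin (M i) → ℂ) => E i p.1 X p.2) (cStrip γ r ×ˢ Uc i X)) ∧
    (∀ i, ∀ g ∈ cStrip γ r, ∀ X, ∀ u ∈ Uc i X, ‖E i g X u‖ ≤ E₀ * Real.exp (-κ * (S i).dj X)) ∧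
    (∀ i (g : ℂ) X (u u' : Fin (M i) → ℂ), (∀ a ∈ coords i X, u a = u' a) → E i g X u = E i g X u') ∧
    (∀ i, ∀ g ∈ Icc (0 : ℝ) γ, ∀ᶠ B in 𝓝 (0 : W i), Φ i g B = ∑ X, E i (g : ℂ) X (χ i X B))

/-- **GLUE-ρ2 at given record data** (the SHAPE of the helper target; `Resp` = the record's response-decay ∕
polarization-limit ∕ identification rows, DISPLAYED as a second antecedent and also to be instantiated BY NAME):
«uniform analytic leaves ∧ displayed record rows ⟹ 2′'s β-box».  The helper target the director may file is
`∀ F, GlueRho2At F (recι F) (recS F) (recM F) (recUc F) (recCoords F) (recW F) (recχ F) (recΦ F) (recResp F) (γ₀ F)`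
with every `rec…` a DEFINITION (DEF-1) — NOT this def under `∀ data` (see `glue_forall_data_imp_target`) and NOT
under `∃ data` (junk-true antecedent, see `zero_pieces_force_functional_zero` and HOME STATUS l.3447∕l.3464). -/
def GlueRho2At (F : T4Family) (ι : Type) (S : ι → LocDomainSys) (M : ι → ℕ)
    (Uc : (i : ι) → (S i).Dom → Set (Fin (M i) → ℂ)) (coords : (i : ι) → (S i).Dom → Finset (Fin (M i)))
    (W : ι → Type) [∀ i, TopologicalSpace (W i)] [∀ i, Zero (W i)]
    (χ : (i : ι) → (S i).Dom → W i → (Fin (M i) → ℂ)) (Φ : (i : ι) → ℝ → W i → ℂ)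
    (Resp : Prop) (γ : ℝ) : Prop :=
  (∃ r E₀ κ : ℝ, 0 < r ∧ 0 ≤ E₀ ∧ 0 < κ ∧ AnalyticLeavesUniform ι S M Uc coords W χ Φ γ r E₀ κ) →
    Resp → AbsBetaBoxAtThm1WitnessCCMGenGridGZBAt F

/-- JUNK FACT 1 (why clause (iv) must name the record's functional): the zero family of pieces satisfies the
representation clause at `(i, g)` only if the represented functional vanishes near `B = 0`.  So with `Φ` instantiated
BY NAME to the record's (non-vanishing) functional, `E := 0` does NOT inhabit the antecedent. -/
theorem zero_pieces_force_functional_zero {ι : Type} {S : ι → LocDomainSys} {M : ι → ℕ}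
    {W : ι → Type} [∀ i, TopologicalSpace (W i)] [∀ i, Zero (W i)]
    (χ : (i : ι) → (S i).Dom → W i → (Fin (M i) → ℂ)) (Φ : (i : ι) → ℝ → W i → ℂ) (i : ι) (g : ℝ)
    (h : ∀ᶠ B in 𝓝 (0 : W i),
      Φ i g B = ∑ X, (fun (_ : ι) (_ : ℂ) (_ : (S i).Dom) (_ : Fin (M i) → ℂ) => (0 : ℂ)) i (g : ℂ) X (χ i X B)) :
    ∀ᶠ B in 𝓝 (0 : W i), Φ i g B = 0 := by
  filter_upwards [h] with B hB
  simpa using hB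

/-- JUNK FACT 2 (why the data tuple must be INSTANTIATED BY NAME, not universally quantified): the glue under
`∀ data` already implies 2′ outright — take the empty index type, where the antecedent is vacuously inhabited by the
empty family of pieces and `Resp := True`.  Hence «`∀ data, GlueRho2At F data`» is 2′ in costume (SAME-WALL), not a
helper. -/
theorem glue_forall_data_imp_target (F : T4Family)
    (h : ∀ (ι : Type) (S : ι → LocDomainSys) (M : ι → ℕ)
      (Uc : (i : ι) → (S i).Dom → Set (Fin (M i) → ℂ)) (coords : (i : ι) → (S i).Dom → Finset (Fin (M i)))
      (W : ι → Type) (_ : ∀ i, TopologicalSpace (W i)) (_ : ∀ i, Zero (W i))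
      (χ : (i : ι) → (S i).Dom → W i → (Fin (M i) → ℂ)) (Φ : (i : ι) → ℝ → W i → ℂ) (Resp : Prop) (γ : ℝ),
      GlueRho2At F ι S M Uc coords W χ Φ Resp γ) :
    AbsBetaBoxAtThm1WitnessCCMGenGridGZBAt F := by
  have h0 := h PEmpty (fun i => i.elim) (fun i => i.elim) (fun i => i.elim) (fun i => i.elim)
    (fun _ => PUnit) (fun _ => inferInstance) (fun _ => inferInstance) (fun i => i.elim) (fun i => i.elim) True 1
  refine h0 ⟨1, 0, 1, one_pos, le_rfl, one_pos, ?_⟩ trivial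
  exact ⟨fun i => i.elim, fun i => i.elim, fun i => i.elim, fun i => i.elim, fun i => i.elim⟩

/-- JUNK FACT 2′ (the converse bookkeeping): if 2′ holds, every instance of the glue holds — so the glue is never
STRONGER than 2′; its value is exactly the displayed antecedent at the record's names. -/
theorem glue_of_target (F : T4Family) (hF : AbsBetaBoxAtThm1WitnessCCMGenGridGZBAt F) (ι : Type)
    (S : ι → LocDomainSys) (M : ι → ℕ)
    (Uc : (i : ι) → (S i).Dom → Set (Fin (M i) → ℂ)) (coords : (i : ι) → (S i).Dom → Finset (Fin (M i)))
    (W : ι → Type) [∀ i, TopologicalSpace (W i)] [∀ i, Zero (W i)]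
    (χ : (i : ι) → (S i).Dom → W i → (Fin (M i) → ℂ)) (Φ : (i : ι) → ℝ → W i → ℂ) (Resp : Prop) (γ : ℝ) :
    GlueRho2At F ι S M Uc coords W χ Φ Resp γ :=
  fun _ _ => hF

end Summit.QuantumFields.YangMills.Cruxes.Record13SepCoPHInhabited.Crit1GlueRho2

end
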